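import Summits.CriticalPhenomena.PercolationContinuityZ3.Theorems.Transplant.FKConnectivityAllQForestHubPairDecomposition
import HarnessLib

/-!
# The e-toggle involution: the square-free adjacent forest Rayleigh node lives on the colourings whose second class joins `o` and `v`

Support file (`--supports stmt-CriticalPhenomena-4575`), FK sub-lane `prim-bschramm-fk-1` (generation 30) of the post-continuity
programme; builds on p205010 (kernel theorem, internal audit signed; external expert review pending).  No definitions, no named facts,
no sorries; standard axioms.

SETTING: a fibre `(M, u)` of the node (♣)⁰ = `AdjForestRayleighNoSqOn` with `e = ov`, `f = oy` free (`e, f ∈ M`, `e ≠ f`); colourings `(ω, ω ∆ M)`;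
`bad = #(Fo ∩ {e,f ∈ ω}, Fo)`, `good = #(Fo ∩ {e ∈ ω}, Fo ∩ {f})`.

THE INVOLUTION (memo bschramm/FROM-fk-1-g30-LAMAN-IDENTITIES.md §1(1b)): on the configurations of the fibre containing `e`, the map
`ω ↦ ω ∆ (M ∖ {e})` — swap the two classes on every free pair EXCEPT `e` — sends `ω` to `(ω ∆ M) ∪ {e}` and its partner to `ω ∖ {e}`.  It is
defined inside the node's events exactly when the second class can absorb `e`, i.e. `(ω ∆ M) ∪ {e}` is a forest, i.e. `o ≁ v` in `ω ∆ M`, and then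
it exchanges `f` between the classes.  Hence (**`adjForestNoSq_bad_absorb_eq_good_absorb`**) the bad and the good colourings whose second class
does NOT join `o` to `v` are EQUINUMEROUS on every fibre, so (**`adjForestNoSq_fibre_iff_joinB`**) the node's inequality on a fibre is EQUIVALENT to
the same inequality restricted to the colourings whose second class joins `o` and `v` (`ω ∆ M ∈ reachEv o v`) — g27's numerically observed
"(CR)₁ × B-join literal" is not a strengthening but the node itself.  At the Laman level (colourings = (tree, 2-forest)) this is the identity
`margin = a + b` of the memo (§0 item 2): the node there is `J_{ov} ≥ 0`.
[cite: SempleWelsh2008, Conj. 1.1 (p. 2); Thm. 4.2 (p. 11)] [cite: CibulkaHladkyLaCroixWagner2008, Thm. 1 (p. 2)] [cite: Linusson2011, Prop. 2.6]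
[cite: Grimmett2006, §1.5 (p. 13)]
-/

noncomputable section

namespace Summit.CriticalPhenomena.PercolationContinuityZ3.Theorems
namespace FK

open Set Literature.Probability.LatticeModels Literature.Probability.Percolation
open scoped Classical symmDiff

variable {V : Type*} [Fintype V]

section ToggleE

variable {M u : BondConfig V} {e f : Sym2 V}

omit [Fintype V] in
/-- Toggling every free pair except `e` on a configuration containing the free pair `e`: `ω ∆ (M ∖ {e}) = (ω ∆ M) ∪ {e}`. [folklore] -/
theorem symmDiff_sdiff_singleton_eq_insert (ω : BondConfig V) (heM : e ∈ M) (heω : e ∈ ω) :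
    ω ∆ (M \ {e}) = insert e (ω ∆ M) := by
  ext g
  simp only [mem_symmDiff, mem_insert_iff, mem_sdiff, mem_singleton_iff]
  by_cases hg : g = e
  · subst hg; tauto
  · tauto

omit [Fintype V] in
/-- The partner of the toggled configuration is the old configuration minus `e`: `(ω ∆ (M ∖ {e})) ∆ M = ω ∖ {e}`. [folklore] -/
theorem symmDiff_sdiff_singleton_symmDiff (ω : BondConfig V) (heM : e ∈ M) (heω : e ∈ ω) :
    (ω ∆ (M \ {e})) ∆ M = ω \ {e} := by
  ext g
  simp only [mem_symmDiff, mem_sdiff, mem_singleton_iff]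
  by_cases hg : g = e
  · subst hg; tauto
  · tauto

omit [Fintype V] in
/-- The toggle preserves the fibre: `(ω ∆ (M ∖ {e})) ∖ M = ω ∖ M`. [folklore] -/
theorem symmDiff_sdiff_singleton_sdiff (ω : BondConfig V) (e : Sym2 V) :
    (ω ∆ (M \ {e})) \ M = ω \ M := by
  ext g
  simp only [mem_sdiff, mem_symmDiff, mem_singleton_iff]
  tauto

omit [Fintype V] in
/-- A sub-configuration of a forest configuration is a forest configuration. [folklore] -/
theorem forestEv_of_subset {ω ζ : BondConfig V} (hω : ω ∈ forestEv V) (h : ζ ⊆ ω) : ζ ∈ forestEv V :=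
  ⟨fun g hg => hω.1 g (h hg), hω.2.anti (openGraph_mono h)⟩

/-- **THE e-TOGGLE IDENTITY.**  On every fibre `(M, u)` with `e ∈ M` free and `f ≠ e`: the BAD colourings (`e, f` in the first class) whose
second class can absorb `e` (second class plus `e` still a forest) are equinumerous with the GOOD colourings (`e` first, `f` second) whose second
class can absorb `e` — via `ω ↦ ω ∆ (M ∖ {e})`. [cite: CibulkaHladkyLaCroixWagner2008, Thm. 1 (p. 2)] [cite: Linusson2011, Prop. 2.6] -/
theorem adjForestNoSq_bad_absorb_eq_good_absorb (heM : e ∈ M) (hef : e ≠ f) :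
    fibreCount M u (forestEv V ∩ {ω | e ∈ ω ∧ f ∈ ω}) (forestEv V ∩ {ζ | insert e ζ ∈ forestEv V}) =
      fibreCount M u (forestEv V ∩ {ω | e ∈ ω}) (forestEv V ∩ {ζ | f ∈ ζ} ∩ {ζ | insert e ζ ∈ forestEv V}) := by
  refine fibreCount_eq_of_bij (fun ω => ω ∆ (M \ {e})) (fun ω => ω ∆ (M \ {e})) (fun ω hω hA hB => ?_) (fun ω hω hA hB => ?_)
  · -- forward: ω bad with absorbable partner
    have hωF : ω ∈ forestEv V := hA.1
    have heω : e ∈ ω := hA.2.1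
    have hfω : f ∈ ω := hA.2.2
    have hBe : insert e (ω ∆ M) ∈ forestEv V := hB.2
    have h1 := symmDiff_sdiff_singleton_eq_insert (M := M) ω heM heω
    have h2 := symmDiff_sdiff_singleton_symmDiff (M := M) ω heM heω
    have hfib : (ω ∆ (M \ {e})) \ M = u := by rw [symmDiff_sdiff_singleton_sdiff, hω]
    have hA1 : ω ∆ (M \ {e}) ∈ forestEv V := by rw [h1]; exact hBe
    have hA2 : e ∈ ω ∆ (M \ {e}) := by rw [h1]; exact mem_insert _ _
    have hB1 : (ω ∆ (M \ {e})) ∆ M ∈ forestEv V := by rw [h2]; exact forestEv_of_subset hωF sdiff_subset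
    have hB2 : f ∈ (ω ∆ (M \ {e})) ∆ M := by
      rw [h2]; exact ⟨hfω, fun h => hef (mem_singleton_iff.1 h).symm⟩
    have hB3 : insert e ((ω ∆ (M \ {e})) ∆ M) ∈ forestEv V := by
      rw [h2, insert_sdiff_singleton, insert_eq_of_mem heω]; exact hωF
    exact ⟨hfib, ⟨hA1, hA2⟩, ⟨⟨hB1, hB2⟩, hB3⟩, symmDiff_symmDiff_cancel_right _ _⟩
  · -- backward: ω good with absorbable partner
    have hωF : ω ∈ forestEv V := hA.1
    have heω : e ∈ ω := hA.2
    have hfB : f ∈ ω ∆ M := hB.1.2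
    have hBe : insert e (ω ∆ M) ∈ forestEv V := hB.2
    have h1 := symmDiff_sdiff_singleton_eq_insert (M := M) ω heM heω
    have h2 := symmDiff_sdiff_singleton_symmDiff (M := M) ω heM heω
    have hfib : (ω ∆ (M \ {e})) \ M = u := by rw [symmDiff_sdiff_singleton_sdiff, hω]
    have hA1 : ω ∆ (M \ {e}) ∈ forestEv V := by rw [h1]; exact hBe
    have hA2 : e ∈ ω ∆ (M \ {e}) := by rw [h1]; exact mem_insert _ _
    have hA3 : f ∈ ω ∆ (M \ {e}) := by rw [h1]; exact mem_insert_of_mem _ hfB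
    have hB1 : (ω ∆ (M \ {e})) ∆ M ∈ forestEv V := by rw [h2]; exact forestEv_of_subset hωF sdiff_subset
    have hB3 : insert e ((ω ∆ (M \ {e})) ∆ M) ∈ forestEv V := by
      rw [h2, insert_sdiff_singleton, insert_eq_of_mem heω]; exact hωF
    exact ⟨hfib, ⟨hA1, hA2, hA3⟩, ⟨hB1, hB3⟩, symmDiff_symmDiff_cancel_right _ _⟩

/-- **THE NODE LIVES ON `{o ~ v in the second class}`.**  For a fibre `(M, u)` with `e = ov ∈ M` free, `o ≠ v`, `f = oy ≠ e`:
`bad ≤ good` ⟺ `bad' ≤ good'`, where the primed counts are restricted to the colourings whose SECOND class joins `o` to `v`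
(`ω ∆ M ∈ reachEv o v`).  [cite: SempleWelsh2008, Conj. 1.1 (p. 2)] [cite: CibulkaHladkyLaCroixWagner2008, Thm. 1 (p. 2)] [cite: Linusson2011, Prop. 2.6] -/
theorem adjForestNoSq_fibre_iff_joinB {o v y : V} (hov : o ≠ v) (heM : s(o, v) ∈ M) (hef : s(o, v) ≠ s(o, y)) :
    (fibreCount M u (forestEv V ∩ {ω | s(o, v) ∈ ω ∧ s(o, y) ∈ ω}) (forestEv V) ≤
        fibreCount M u (forestEv V ∩ {ω | s(o, v) ∈ ω}) (forestEv V ∩ {ω | s(o, y) ∈ ω})) ↔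
      (fibreCount M u (forestEv V ∩ {ω | s(o, v) ∈ ω ∧ s(o, y) ∈ ω}) (forestEv V ∩ reachEv o v) ≤
        fibreCount M u (forestEv V ∩ {ω | s(o, v) ∈ ω}) (forestEv V ∩ {ω | s(o, y) ∈ ω} ∩ reachEv o v)) := by
  -- split the second slot of both counts by `reachEv o v`
  have hsplit : ∀ (A B : Set (BondConfig V)),
      fibreCount M u A (forestEv V ∩ B) =
        fibreCount M u A (forestEv V ∩ B ∩ reachEv o v) + fibreCount M u A (forestEv V ∩ B ∩ (reachEv o v)ᶜ) := by
    intro A B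
    rw [← fibreCount_split_right M u A (Set.disjoint_of_subset inter_subset_right inter_subset_right
      disjoint_compl_right)]
    congr 1
    rw [← inter_union_distrib_left, union_compl_self, inter_univ]
  -- on a partner avoiding `o ~ v`, the pair `e` is absorbable, and conversely
  have hkey : ∀ ω : BondConfig V, s(o, v) ∈ ω → ω ∆ M ∈ forestEv V →
      (ω ∆ M ∈ (reachEv o v)ᶜ ↔ insert s(o, v) (ω ∆ M) ∈ forestEv V) := by
    intro ω heω hF
    have heB : s(o, v) ∉ ω ∆ M := fun h => (mem_symmDiff.1 h).elim (fun h' => h'.2 heM) (fun h' => h'.2 heω)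
    rw [insert_mem_forestEv_iff hov heB]
    exact ⟨fun hR => ⟨hF, hR⟩, fun h => h.2⟩
  have hbadc : fibreCount M u (forestEv V ∩ {ω | s(o, v) ∈ ω ∧ s(o, y) ∈ ω}) (forestEv V ∩ univ ∩ (reachEv o v)ᶜ) =
      fibreCount M u (forestEv V ∩ {ω | s(o, v) ∈ ω ∧ s(o, y) ∈ ω}) (forestEv V ∩ {ζ | insert s(o, v) ζ ∈ forestEv V}) := by
    refine fibreCount_congr_fibre M u (fun ω _ => ?_)
    constructor
    · rintro ⟨hA, ⟨hF, -⟩, hR⟩; exact ⟨hA, hF, (hkey ω hA.2.1 hF).1 hR⟩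
    · rintro ⟨hA, hF, hI⟩; exact ⟨hA, ⟨hF, mem_univ _⟩, (hkey ω hA.2.1 hF).2 hI⟩
  have hgoodc : fibreCount M u (forestEv V ∩ {ω | s(o, v) ∈ ω}) (forestEv V ∩ {ω | s(o, y) ∈ ω} ∩ (reachEv o v)ᶜ) =
      fibreCount M u (forestEv V ∩ {ω | s(o, v) ∈ ω})
        (forestEv V ∩ {ζ | s(o, y) ∈ ζ} ∩ {ζ | insert s(o, v) ζ ∈ forestEv V}) := by
    refine fibreCount_congr_fibre M u (fun ω _ => ?_)
    constructor
    · rintro ⟨hA, ⟨hF, hf⟩, hR⟩; exact ⟨hA, ⟨hF, hf⟩, (hkey ω hA.2 hF).1 hR⟩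
    · rintro ⟨hA, ⟨hF, hf⟩, hI⟩; exact ⟨hA, ⟨hF, hf⟩, (hkey ω hA.2 hF).2 hI⟩
  have heq := adjForestNoSq_bad_absorb_eq_good_absorb (u := u) heM hef
  have hb := hsplit (forestEv V ∩ {ω | s(o, v) ∈ ω ∧ s(o, y) ∈ ω}) univ
  have hg := hsplit (forestEv V ∩ {ω | s(o, v) ∈ ω}) {ω | s(o, y) ∈ ω}
  rw [hbadc] at hb
  rw [hgoodc, ← heq] at hg
  rw [inter_univ] at hb
  rw [hb, hg]
  omega

end ToggleE

end FK
end Summit.CriticalPhenomena.PercolationContinuityZ3.Theorems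

end
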